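import Summits.ResolutionOfSingularities.ResolutionOfSingularities.Theorems.FrobeniusClosingSteerCurveEscapeStep
import HarnessLib

/-!
# Crux `Steer` (stmt-ResolutionOfSingularities-16345), chain W4.1, σ-residual SUPPORT: **CurveEscape**
# (helper γ, part 2 of 2; Theses-free, def-free)

OURS (campaign `res-hironaka`, rung L ★L-G4, slot W4.1; a statement about the route's own objects — sequences of
quadratic transforms of local rings along a valuation ring (`Resolution.IsQuadraticTransformAlong`,
`QuadraticTransforms.lean`); it replaces the role of no printed item and is NOT a statement of the manuscript under
review [claim: Hironaka2017, status: under-review]; AI review is weaker than expert review). ORDER γ of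
res-L0-w41-plan-1 (HOME/STATUS 2026-08-27T06:15:18Z; sketch `L/w41/Sketch-CurveEscape.lean` sha16 240ea8550b380136,
whose two `Prop`s `CurveEscape` / `CurveEscapeBound` are proved here in their verbatim shape as `curveEscape` /
`curveEscapeBound`); seat res-type-038. Part 1 = `FrobeniusClosingSteerCurveEscapeStep.lean` (one step).

## The statements

Let `O ⊆ K` be a valuation ring and `R 0 → R 1 → ⋯` local subrings of `K`, `R (i+1)` the quadratic transform of `R i`
ALONG `O` (`R (i+1) = (R i)[𝔪_i/x_i]_{𝔪_O ∩ …}`, `x_i ∈ 𝔪_i` of minimal value); `P i ⊂ R i` primes with `P i ≠ 𝔪_i`,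
`P (i+1) ∩ R i = P i` (the strict transforms of ONE curve hosting every centre) and `R i ⧸ P i` regular of dimension one.
* `curveEscape`: if the value group is archimedean (`∀ x y, y ≠ 0 → v x < 1 → ∃ n, v x ^ n < v y`) and `P i ≠ 0`,
  this is impossible.
* `curveEscapeBound` (engine sanity A6): if `𝔪_0 = P 0 + (z)`, `0 ≠ u ∈ P 0` and `v z ^ n < v u`, the hypotheses can
  hold for all `i < N` only if `N ≤ n` — in fact only if `N < n` (`curveEscapeBound_lt`).

## Proof (res-L0-w41-plan-1's half page, made kernel-tight; one-step facts from part 1)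

ALONG THE SEQUENCE (base index `0`, `O` dominating `R 0`, `𝔪_0 ⊆ P 0 + z·R 0`): `u/(x_0⋯x_{n−1}) ∈ P n`, so
`v u ≤ ∏ v x_j` (`valuation_le_prod`); lifting every `r' ∈ R n` down to `R 0` modulo `P n`
(`exists_sub_inclusion_mem_base`) gives `𝔪_n ⊆ P n + z·R 0`, whence `v x_n ≤ v z` (`valuation_param_le`:
`x_n = p + c z` with `v p < v x_n`, `v c ≤ 1`); so `v u ≤ v z ^ N` (`valuation_le_pow`). KEY REMARK making the Bound
hold AS TYPED (no domination hypothesis on `R 0`): under its hypotheses `O` dominates `R 0` automatically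
(`subringDominates_base`: every element of `𝔪_0 = P 0 + (z)` has value `≤ max (v p, v c·v z) < 1`, as `v p < v x_0 ≤ 1`
and `v z < 1` because `v z ^ n < v u ≤ 1`). For `curveEscape` the sequence is shifted by one (`R 1` is dominated by `O`
for free) and `z` is a lift of a generator of the maximal ideal of the discrete valuation ring `R 1 ⧸ P 1`
(regular of dimension one ⇒ principal, tree `isPrincipalIdealRing_of_ringKrullDim_le_one`).

Def-free, sorry-free. Consumers (per the ORDER): res-L0-k41 / strat-2 (K4.1f v3 sanity A6: a regular curve hosts the
centre `< n` steps once `v z ^ n < v u`), idea-3 (PT₁), tri-3 (ALT₁ probes).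
-/

noncomputable section

set_option linter.dupNamespace false

namespace Summit.ResolutionOfSingularities.ResolutionOfSingularities.Theorems.SwitchingDichotomy.CurveEscape

open IsLocalRing Literature.AlgebraicGeometry.Resolution

universe u

variable {K : Type u} [Field K]

/-! ## §2 Along the sequence: transport of the primes, the escaping fraction `u/(x_0⋯x_{n−1})`, the bound -/

section Sequence

variable {O : ValuationSubring K} {R : ℕ → Subring K}
  (hq : ∀ i, IsQuadraticTransformAlong O (R i) (R (i + 1))) [∀ i, IsLocalRing (R i)]
  {P : (i : ℕ) → Ideal (R i)} [∀ i, (P i).IsPrime] {N : ℕ}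
  (hP𝔪 : ∀ i < N, P i ≠ maximalIdeal (R i))
  (hc : ∀ i < N, (P (i + 1)).comap (Subring.inclusion (hq i).le) = P i)
  {x : (i : ℕ) → R i} (hx𝔪 : ∀ i, x i ∈ maximalIdeal (R i)) (hx0 : ∀ i, x i ≠ 0)
  (hR : ∀ i, R (i + 1) = locAtCentre (blowupRing (R i) (x i : K)) O)

omit [∀ i, IsLocalRing (R i)] [∀ i, (P i).IsPrime] in
include hc in
/-- Transport of the primes along the inclusions `R i ≤ R j` (`i ≤ j ≤ N`): `u ∈ P i ↔ u ∈ P j`. OURS bookkeeping.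
[folklore] -/
theorem inclusion_mem_iff {i j : ℕ} (hij : i ≤ j) (hjN : j ≤ N) (u : R i) :
    Subring.inclusion (sequence_monotone hq hij) u ∈ P j ↔ u ∈ P i := by
  induction j, hij using Nat.le_induction with
  | base =>
    have heq : Subring.inclusion (sequence_monotone hq (le_refl i)) u = u := Subtype.ext rfl
    rw [heq]
  | succ j hij ih =>
    have hjN' : j < N := Nat.lt_of_succ_le hjN
    have heq : Subring.inclusion (sequence_monotone hq (Nat.le_succ_of_le hij)) u =
        Subring.inclusion (hq j).le (Subring.inclusion (sequence_monotone hq hij) u) := Subtype.ext rfl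
    rw [heq, ← Ideal.mem_comap, hc j hjN', ih hjN'.le]

include hP𝔪 hc hx0 hR in
/-- **The escaping fraction**: for `u ∈ P 0` and `n ≤ N`, `u/(x_0⋯x_{n−1})` lies in `P n`. OURS. [folklore] -/
theorem exists_eq_div_prod_mem {u : R 0} (hu : u ∈ P 0) {n : ℕ} (hn : n ≤ N) :
    ∃ w : R n, (w : K) = (u : K) / ∏ j ∈ Finset.range n, (x j : K) ∧ w ∈ P n := by
  induction n with
  | zero => exact ⟨u, by simp, hu⟩
  | succ n ih =>
    have hnN : n < N := Nat.lt_of_succ_le hn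
    obtain ⟨w, hw, hwP⟩ := ih hnN.le
    obtain ⟨w', hw', hw'P⟩ := exists_div_mem_of_mem (hq n) (hx0 n) (hR n) (hP𝔪 n hnN) (hc n hnN) hwP
    refine ⟨w', ?_, hw'P⟩
    rw [hw', hw, Finset.prod_range_succ, div_div]

include hP𝔪 hc hx0 hR in
/-- `v u ≤ ∏_{j<n} v x_j` for `u ∈ P 0`, `n ≤ N` (the escaping fraction lies in `R n ⊆ O`). OURS. [folklore] -/
theorem valuation_le_prod {u : R 0} (hu : u ∈ P 0) {n : ℕ} (hn : n ≤ N) :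
    O.valuation (u : K) ≤ ∏ j ∈ Finset.range n, O.valuation (x j : K) := by
  obtain ⟨w, hw, -⟩ := exists_eq_div_prod_mem hq hP𝔪 hc hx0 hR hu hn
  have hprod : (∏ j ∈ Finset.range n, (x j : K)) ≠ 0 :=
    Finset.prod_ne_zero_iff.mpr fun j _ e => hx0 j (Subtype.ext e)
  have h1 : O.valuation (w : K) ≤ 1 := (O.valuation_le_one_iff _).mpr ((hq n).source_le w.2)
  rw [hw, map_div₀, div_le_one₀ (pos_iff_ne_zero.mpr ((map_ne_zero _).mpr hprod)), map_prod] at h1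
  exact h1

omit [∀ i, IsLocalRing (R i)] [∀ i, (P i).IsPrime] in
include hq in
/-- Every member of the sequence is dominated by `O`, provided `R 0` is. OURS bookkeeping. [folklore] -/
theorem subringDominates_of_base (h0 : SubringDominates (R 0) O.toSubring) (i : ℕ) :
    SubringDominates (R i) O.toSubring := by
  cases i with
  | zero => exact h0
  | succ i => exact (hq i).dominated

include hP𝔪 hc hx0 hR in
/-- **Lifting down to the base**: if `O` dominates `R 0` and the residue rings `R i ⧸ P i` (`i < N`) are valuation
rings, every `r' ∈ R n` (`n ≤ N`) is congruent modulo `P n` to an element of `R 0`. OURS. [folklore] -/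
theorem exists_sub_inclusion_mem_base (h0 : SubringDominates (R 0) O.toSubring)
    (hval : ∀ i < N, ValuationRing (R i ⧸ P i)) {n : ℕ} (hn : n ≤ N) (r' : R n) :
    ∃ r : R 0, r' - Subring.inclusion (sequence_monotone hq (Nat.zero_le n)) r ∈ P n := by
  induction n with
  | zero =>
    refine ⟨r', ?_⟩
    have heq : Subring.inclusion (sequence_monotone hq (Nat.zero_le 0)) r' = r' := Subtype.ext rfl
    rw [heq, sub_self]
    exact (P 0).zero_mem
  | succ n ih =>
    have hnN : n < N := Nat.lt_of_succ_le hn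
    haveI := hval n hnN
    obtain ⟨r₁, hr₁⟩ := exists_sub_inclusion_mem (hq n) (subringDominates_of_base hq h0 n) (hx0 n) (hR n)
      (hP𝔪 n hnN) (hc n hnN) r'
    obtain ⟨r, hr⟩ := ih hnN.le r₁
    refine ⟨r, ?_⟩
    have h1 : Subring.inclusion (hq n).le (r₁ - Subring.inclusion (sequence_monotone hq (Nat.zero_le n)) r) ∈
        P (n + 1) := by
      rw [← Ideal.mem_comap, hc n hnN]
      exact hr
    have h2 : r' - Subring.inclusion (sequence_monotone hq (Nat.zero_le (n + 1))) r =
        (r' - Subring.inclusion (hq n).le r₁) +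
          Subring.inclusion (hq n).le (r₁ - Subring.inclusion (sequence_monotone hq (Nat.zero_le n)) r) := by
      apply Subtype.ext
      push_cast [Subring.coe_inclusion]
      ring
    rw [h2]
    exact (P (n + 1)).add_mem hr₁ h1

include hP𝔪 hc hx𝔪 hx0 hR in
/-- **`v x_n ≤ v z`** (`n < N`): with `𝔪_0 ⊆ P 0 + z·R 0` and the lifting, `x_n = p + c z` with `p ∈ P n`,
`c ∈ R 0`; as `v p < v x_n` (the one-step inequality) and `v c ≤ 1`, `v x_n ≤ v z`. OURS. [folklore] -/
theorem valuation_param_le (h0 : SubringDominates (R 0) O.toSubring)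
    (hval : ∀ i < N, ValuationRing (R i ⧸ P i)) {z : R 0}
    (hz : maximalIdeal (R 0) ≤ P 0 ⊔ Ideal.span {z}) {n : ℕ} (hn : n < N) :
    O.valuation (x n : K) ≤ O.valuation (z : K) := by
  obtain ⟨r, hr⟩ := exists_sub_inclusion_mem_base hq hP𝔪 hc hx0 hR h0 hval hn.le (x n)
  set ι := Subring.inclusion (sequence_monotone hq (Nat.zero_le n)) with hι
  have hvp₁ : O.valuation ((x n - ι r : R n) : K) < O.valuation (x n : K) :=
    valuation_lt_of_mem (hq n) (hx0 n) (hR n) (hP𝔪 n hn) (hc n hn) hr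
  have hvxn : O.valuation (x n : K) < 1 :=
    (mem_maximalIdeal_iff_valuation_lt_one (subringDominates_of_base hq h0 n) (x n)).mp (hx𝔪 n)
  -- `r ∈ 𝔪_0`
  have hrK : (r : K) = (x n : K) - ((x n - ι r : R n) : K) := by
    rw [hι]
    push_cast [Subring.coe_inclusion]
    ring
  have hr𝔪 : r ∈ maximalIdeal (R 0) := by
    rw [mem_maximalIdeal_iff_valuation_lt_one h0, hrK]
    exact lt_of_le_of_lt (Valuation.map_sub _ _ _) (max_lt hvxn (lt_trans hvp₁ hvxn))
  obtain ⟨p₀, hp₀, cz, hcz, hsum⟩ := Submodule.mem_sup.mp (hz hr𝔪)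
  obtain ⟨c, rfl⟩ := Ideal.mem_span_singleton'.mp hcz
  -- `p := (x n - ι r) + ι p₀ ∈ P n` and `x n = p + c z`
  have hp₀n : ι p₀ ∈ P n := (inclusion_mem_iff hq hc (Nat.zero_le n) hn.le p₀).mpr hp₀
  have hpn : (x n - ι r) + ι p₀ ∈ P n := (P n).add_mem hr hp₀n
  have hvp : O.valuation (((x n - ι r) + ι p₀ : R n) : K) < O.valuation (x n : K) :=
    valuation_lt_of_mem (hq n) (hx0 n) (hR n) (hP𝔪 n hn) (hc n hn) hpn
  have hrK' : (r : K) = (p₀ : K) + (c : K) * z := by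
    rw [← hsum, Subring.coe_add, Subring.coe_mul]
  have hdecomp : (x n : K) = (((x n - ι r) + ι p₀ : R n) : K) + (c : K) * z := by
    rw [hι]
    push_cast [Subring.coe_inclusion]
    rw [hrK']
    ring
  have hcz' : O.valuation ((c : K) * z) ≤ O.valuation (z : K) := by
    rw [map_mul]
    have hc1 : O.valuation (c : K) ≤ 1 := (O.valuation_le_one_iff _).mpr ((hq 0).source_le c.2)
    calc O.valuation (c : K) * O.valuation (z : K) ≤ 1 * O.valuation (z : K) := mul_le_mul' hc1 le_rfl
      _ = O.valuation (z : K) := one_mul _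
  have hle : O.valuation (x n : K) ≤
      max (O.valuation (((x n - ι r) + ι p₀ : R n) : K)) (O.valuation ((c : K) * z)) := by
    conv_lhs => rw [hdecomp]
    exact Valuation.map_add _ _ _
  rcases le_max_iff.mp hle with h1 | h1
  · exact absurd h1 (not_le.mpr hvp)
  · exact h1.trans hcz'

include hP𝔪 hc hx𝔪 hx0 hR in
/-- **`v u ≤ (v z)^N`** for `u ∈ P 0`, when `O` dominates `R 0`, the residue rings `R i ⧸ P i` (`i < N`) are
valuation rings and `𝔪_0 ⊆ P 0 + z·R 0`. OURS. [folklore] -/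
theorem valuation_le_pow (h0 : SubringDominates (R 0) O.toSubring)
    (hval : ∀ i < N, ValuationRing (R i ⧸ P i)) {z : R 0}
    (hz : maximalIdeal (R 0) ≤ P 0 ⊔ Ideal.span {z}) {u : R 0} (hu : u ∈ P 0) :
    O.valuation (u : K) ≤ O.valuation (z : K) ^ N := by
  refine (valuation_le_prod hq hP𝔪 hc hx0 hR hu le_rfl).trans ?_
  have key : ∀ n, n ≤ N → ∏ j ∈ Finset.range n, O.valuation (x j : K) ≤ O.valuation (z : K) ^ n := by
    intro n hn
    induction n with
    | zero => simp
    | succ n ih =>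
      rw [Finset.prod_range_succ, pow_succ]
      exact mul_le_mul' (ih (Nat.le_of_succ_le hn))
        (valuation_param_le hq hP𝔪 hc hx𝔪 hx0 hR h0 hval hz (Nat.lt_of_succ_le hn))
  exact key N le_rfl

include hP𝔪 hc hx0 hR in
/-- **Domination of the base is automatic** (`N ≥ 1`): if `𝔪_0 ⊆ P 0 + z·R 0` with `v z < 1`, then `O` dominates
`R 0` — every `p ∈ P 0` has `v p < v x_0 ≤ 1`. This is why `curveEscapeBound` needs no domination hypothesis.
OURS. [folklore] -/
theorem subringDominates_base (hN : 0 < N) {z : R 0} (hz : maximalIdeal (R 0) ≤ P 0 ⊔ Ideal.span {z})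
    (hvz : O.valuation (z : K) < 1) : SubringDominates (R 0) O.toSubring := by
  rw [subringDominates_valuationSubring_iff (hq 0).source_le]
  intro a
  constructor
  · intro ha
    obtain ⟨p, hp, cz, hcz, hsum⟩ := Submodule.mem_sup.mp (hz ha)
    obtain ⟨c, rfl⟩ := Ideal.mem_span_singleton'.mp hcz
    have hvp : O.valuation (p : K) < 1 :=
      lt_of_lt_of_le (valuation_lt_of_mem (hq 0) (hx0 0) (hR 0) (hP𝔪 0 hN) (hc 0 hN) hp)
        ((O.valuation_le_one_iff _).mpr ((hq 0).source_le (x 0).2))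
    have hvc : O.valuation ((c : K) * z) < 1 := by
      rw [map_mul]
      have hc1 : O.valuation (c : K) ≤ 1 := (O.valuation_le_one_iff _).mpr ((hq 0).source_le c.2)
      calc O.valuation (c : K) * O.valuation (z : K) ≤ 1 * O.valuation (z : K) := mul_le_mul' hc1 le_rfl
        _ = O.valuation (z : K) := one_mul _
        _ < 1 := hvz
    have haK : (a : K) = (p : K) + (c : K) * z := by
      rw [← hsum, Subring.coe_add, Subring.coe_mul]
    rw [haK]
    exact lt_of_le_of_lt (Valuation.map_add _ _ _) (max_lt hvp hvc)
  · intro hlt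
    rw [IsLocalRing.mem_maximalIdeal, mem_nonunits_iff]
    intro hunit
    rw [isUnit_subring_iff_inv_mem] at hunit
    have h1 : O.valuation ((a : K)⁻¹) ≤ 1 := (O.valuation_le_one_iff _).mpr ((hq 0).source_le hunit.2)
    rw [map_inv₀, inv_le_one₀ (pos_iff_ne_zero.mpr ((map_ne_zero _).mpr hunit.1))] at h1
    exact not_lt.mpr h1 hlt

end Sequence

/-! ## §3 The two statements of the sketch, verbatim shape -/

/-- **CurveEscapeBound, sharp form `N < n`**: along a sequence of quadratic transforms along `O`, if
`𝔪_0 = P 0 + (z)`, `0 ≠ u ∈ P 0`, `v z ^ n < v u`, and for all `i < N` the primes `P i ≠ 𝔪_i` have regular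
one-dimensional residue rings and `P (i+1) ∩ R i = P i`, then `N < n` (the centre leaves the strict transforms of
the regular curve `P 0` after fewer than `n` steps). OURS; res-L0-w41-plan-1's engine sanity bound A6, sharpened by
one. [folklore] -/
theorem curveEscapeBound_lt :
    ∀ (K : Type) [Field K] (O : ValuationSubring K)
      (R : ℕ → Subring K) (hq : ∀ i, IsQuadraticTransformAlong O (R i) (R (i + 1)))
      [∀ i, IsLocalRing (R i)] (P : (i : ℕ) → Ideal (R i)) [∀ i, (P i).IsPrime] (N n : ℕ)
      (u z : R 0), u ∈ P 0 → u ≠ 0 → (z : K) ≠ 0 → maximalIdeal (R 0) = P 0 ⊔ Ideal.span {z} →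
      O.valuation (z : K) ^ n < O.valuation (u : K) →
      (∀ i < N, P i ≠ maximalIdeal (R i)) →
      (∀ i < N, IsRegularLocalRing (R i ⧸ P i) ∧ ringKrullDim (R i ⧸ P i) = 1) →
      (∀ i < N, (P (i + 1)).comap (Subring.inclusion (hq i).le) = P i) →
      N < n := by
  intro K _ O R hq _ P _ N n u z hu _hu0 _hz0 h𝔪 hlt hP𝔪 hreg hc
  -- the exceptional parameters `x i` and the shape of each transform
  choose _hloc x hx𝔪 hx0 _hxmax hR using fun i => (hq i).exists_eq_locAtCentre
  have hvu1 : O.valuation (u : K) ≤ 1 := (O.valuation_le_one_iff _).mpr ((hq 0).source_le u.2)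
  have hvz1 : O.valuation (z : K) < 1 := by
    by_contra hge
    have h1 : O.valuation (z : K) = 1 :=
      le_antisymm ((O.valuation_le_one_iff _).mpr ((hq 0).source_le z.2)) (not_lt.mp hge)
    rw [h1, one_pow] at hlt
    exact not_lt.mpr hvu1 hlt
  by_contra hNn
  have hnN : n ≤ N := not_lt.mp hNn
  rcases Nat.eq_zero_or_pos N with hN0 | hNpos
  · subst hN0
    have hn0 : n = 0 := Nat.le_zero.mp hnN
    rw [hn0, pow_zero] at hlt
    exact not_lt.mpr hvu1 hlt
  · have hval : ∀ i < N, ValuationRing (R i ⧸ P i) := fun i hi => by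
      haveI := (hreg i hi).1
      haveI := isPrincipalIdealRing_of_ringKrullDim_le_one (R := R i ⧸ P i) (hreg i hi).2.le
      infer_instance
    have h0 : SubringDominates (R 0) O.toSubring :=
      subringDominates_base hq hP𝔪 hc hx0 hR hNpos h𝔪.le hvz1
    have hle := valuation_le_pow hq hP𝔪 hc hx𝔪 hx0 hR h0 hval h𝔪.le hu
    have hpow : O.valuation (z : K) ^ N ≤ O.valuation (z : K) ^ n := pow_le_pow_right_of_le_one' hvz1.le hnN
    exact lt_irrefl _ (lt_of_lt_of_le hlt (hle.trans hpow))

/-- **CurveEscapeBound** (the sketch's `CurveEscapeBound`, VERBATIM shape): «the centre stays on the strict transforms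
of a regular curve for at most `n` further steps once `O.valuation z ^ n < O.valuation u`» — `N ≤ n`. From
`curveEscapeBound_lt`. OURS (res-L0-w41-plan-1, `L/w41/Sketch-CurveEscape.lean` 240ea8550b380136); engine sanity
bound A6 of K4.1f v3. [folklore] -/
theorem curveEscapeBound :
    ∀ (K : Type) [Field K] (O : ValuationSubring K)
      (R : ℕ → Subring K) (hq : ∀ i, IsQuadraticTransformAlong O (R i) (R (i + 1)))
      [∀ i, IsLocalRing (R i)] (P : (i : ℕ) → Ideal (R i)) [∀ i, (P i).IsPrime] (N n : ℕ)
      (u z : R 0), u ∈ P 0 → u ≠ 0 → (z : K) ≠ 0 → maximalIdeal (R 0) = P 0 ⊔ Ideal.span {z} →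
      O.valuation (z : K) ^ n < O.valuation (u : K) →
      (∀ i < N, P i ≠ maximalIdeal (R i)) →
      (∀ i < N, IsRegularLocalRing (R i ⧸ P i) ∧ ringKrullDim (R i ⧸ P i) = 1) →
      (∀ i < N, (P (i + 1)).comap (Subring.inclusion (hq i).le) = P i) →
      N ≤ n :=
  fun K _ O R hq _ P _ N n u z hu hu0 hz0 h𝔪 hlt hP𝔪 hreg hc =>
    (curveEscapeBound_lt K O R hq P N n u z hu hu0 hz0 h𝔪 hlt hP𝔪 hreg hc).le

/-- **CurveEscape** (the sketch's `CurveEscape`, VERBATIM shape): a valuation ring with ARCHIMEDEAN value group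
(`∀ x y, y ≠ 0 → v x < 1 → ∃ n, v x ^ n < v y`, i.e. rank one) cannot keep its centres on the strict transforms
`P i` (`P (i+1) ∩ R i = P i`, `P i ≠ 𝔪_i`, `P i ≠ 0`, `R i ⧸ P i` regular of dimension one) of one regular curve
for ever along a sequence of quadratic transforms along it. Proof: shift the sequence by one (`R 1` is dominated by
`O`), lift a generator of the maximal ideal of the discrete valuation ring `R 1 ⧸ P 1` to `z ∈ 𝔪_1`, and apply
`valuation_le_pow` to `0 ≠ u ∈ P 1`: `v u ≤ v z ^ n` for every `n`, against the archimedean hypothesis. OURS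
(res-L0-w41-plan-1, `L/w41/Sketch-CurveEscape.lean` 240ea8550b380136). [folklore] -/
theorem curveEscape :
    ∀ (K : Type) [Field K] (O : ValuationSubring K),
      (∀ x y : K, y ≠ 0 → O.valuation x < 1 → ∃ n : ℕ, O.valuation x ^ n < O.valuation y) →
      ∀ (R : ℕ → Subring K) (hq : ∀ i, IsQuadraticTransformAlong O (R i) (R (i + 1)))
        [∀ i, IsLocalRing (R i)] (P : (i : ℕ) → Ideal (R i)) [∀ i, (P i).IsPrime],
        (∀ i, P i ≠ maximalIdeal (R i)) →
        (∀ i, P i ≠ ⊥) →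
        (∀ i, IsRegularLocalRing (R i ⧸ P i) ∧ ringKrullDim (R i ⧸ P i) = 1) →
        (∀ i, (P (i + 1)).comap (Subring.inclusion (hq i).le) = P i) →
        False := by
  intro K _ O hArch R hq _ P _ hP𝔪 hPbot hreg hc
  choose _hloc x hx𝔪 hx0 _hxmax hR using fun i => (hq i).exists_eq_locAtCentre
  -- the residue ring `R 1 ⧸ P 1` is a discrete valuation ring: lift a generator of its maximal ideal
  haveI := (hreg 1).1
  haveI := isPrincipalIdealRing_of_ringKrullDim_le_one (R := R 1 ⧸ P 1) (hreg 1).2.le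
  haveI := IsPrincipalIdealRing.principal (maximalIdeal (R 1 ⧸ P 1))
  obtain ⟨wbar, hwbar⟩ := Submodule.IsPrincipal.principal (maximalIdeal (R 1 ⧸ P 1))
  obtain ⟨w, rfl⟩ := Ideal.Quotient.mk_surjective wbar
  have h𝔪top : maximalIdeal (R 1) ≠ ⊤ := (IsLocalRing.maximalIdeal.isMaximal (R 1)).ne_top
  have hz : maximalIdeal (R 1) ≤ P 1 ⊔ Ideal.span {w} := by
    intro y hy
    have h1 : Ideal.Quotient.mk (P 1) y ∈ maximalIdeal (R 1 ⧸ P 1) := by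
      rw [IsLocalRing.mem_maximalIdeal, mem_nonunits_iff]
      intro hunit
      obtain ⟨t, ht⟩ := hunit.exists_right_inv
      obtain ⟨t, rfl⟩ := Ideal.Quotient.mk_surjective t
      rw [← map_mul, ← map_one (Ideal.Quotient.mk (P 1)), Ideal.Quotient.eq] at ht
      have h2 : y * t - 1 ∈ maximalIdeal (R 1) :=
        IsLocalRing.le_maximalIdeal (Ideal.IsPrime.ne_top inferInstance) ht
      have h3 : (1 : R 1) ∈ maximalIdeal (R 1) := by
        have h4 := (maximalIdeal (R 1)).sub_mem ((maximalIdeal (R 1)).mul_mem_right t hy) h2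
        rwa [sub_sub_cancel] at h4
      exact h𝔪top ((maximalIdeal (R 1)).eq_top_iff_one.mpr h3)
    rw [hwbar] at h1
    change Ideal.Quotient.mk (P 1) y ∈ Ideal.span {Ideal.Quotient.mk (P 1) w} at h1
    obtain ⟨cbar, hcbar⟩ := Ideal.mem_span_singleton'.mp h1
    obtain ⟨c, rfl⟩ := Ideal.Quotient.mk_surjective cbar
    rw [← map_mul, Ideal.Quotient.eq] at hcbar
    refine Submodule.mem_sup.mpr ⟨y - c * w, ?_, c * w, Ideal.mem_span_singleton'.mpr ⟨c, rfl⟩, by ring⟩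
    have h2 := (P 1).neg_mem hcbar
    rwa [neg_sub] at h2
  have hw𝔪 : w ∈ maximalIdeal (R 1) := by
    rw [IsLocalRing.mem_maximalIdeal, mem_nonunits_iff]
    intro hwu
    have h1 : Ideal.Quotient.mk (P 1) w ∈ maximalIdeal (R 1 ⧸ P 1) := by
      rw [hwbar]
      exact Submodule.mem_span_singleton_self _
    exact ((IsLocalRing.mem_maximalIdeal _).mp h1) (hwu.map _)
  -- `0 ≠ u ∈ P 1`; `v w < 1` as `O` dominates `R 1`
  obtain ⟨u, hu, hu0⟩ := Submodule.exists_mem_ne_zero_of_ne_bot (hPbot 1)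
  have hu0' : (u : K) ≠ 0 := fun e => hu0 (Subtype.ext e)
  have h0 : SubringDominates (R 1) O.toSubring := (hq 0).dominated
  have hvw : O.valuation (w : K) < 1 := (mem_maximalIdeal_iff_valuation_lt_one h0 w).mp hw𝔪
  obtain ⟨n, hn⟩ := hArch (w : K) (u : K) hu0' hvw
  -- the core bound on the shifted sequence `i ↦ R (i + 1)` with `N := n`
  have hval : ∀ i < n, ValuationRing (R (i + 1) ⧸ P (i + 1)) := fun i _ => by
    haveI := (hreg (i + 1)).1
    haveI := isPrincipalIdealRing_of_ringKrullDim_le_one (R := R (i + 1) ⧸ P (i + 1)) (hreg (i + 1)).2.le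
    infer_instance
  have hle := valuation_le_pow (R := fun i => R (i + 1)) (fun i => hq (i + 1)) (P := fun i => P (i + 1))
    (N := n) (fun i _ => hP𝔪 (i + 1)) (fun i _ => hc (i + 1)) (x := fun i => x (i + 1))
    (fun i => hx𝔪 (i + 1)) (fun i => hx0 (i + 1)) (fun i => hR (i + 1)) h0 hval hz hu
  exact lt_irrefl _ (lt_of_lt_of_le hn hle)

end Summit.ResolutionOfSingularities.ResolutionOfSingularities.Theorems.SwitchingDichotomy.CurveEscape

end
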